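import Mathlib.LinearAlgebra.Matrix.SchurComplement
import Mathlib.LinearAlgebra.Matrix.Rank
import Mathlib.FieldTheory.Finiteness
import Mathlib.LinearAlgebra.Matrix.GeneralLinearGroup.Defs
import Literature.AlgebraicGeometry.Motives.AbelianVarietyBrauerRelationInflation
import HarnessLib

/-!
# The MIRABOLIC GASSMANN PAIR in `GLₙ(𝔽_q)`: the stabiliser `P₁` of a non-zero VECTOR and the stabiliser `P₂` of a
# non-zero COVECTOR have the same permutation character (for every `n` and every finite field), are not conjugate
# for `n ≥ 3`, and hence `B_{P₁} ∼ B_{P₂}` for every abelian variety with a `GLₙ(𝔽_q)`-action — the general,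
# `decide`-free form of the parabolic example `(SL₃(𝔽₂), P₁, P₂)`; ALGEBRAIC carrier, Hom counts over an arbitrary
# field, isogeny and dimensions over a perfect field

Layer A1/A2 of the Hodge foundations lane (`lit-hodgefound`, row A1-20⁺ · A2, seat p03 generation 25, row g25-#9) on
the ALGEBRAIC carrier `AbelianVariety K` of `Motives/AbelianVariety`; sequel of
`Motives/AbelianVarietyParabolicGassmannTriple` (the case `n = 3`, `q = 2`, by `decide`) and of
`Motives/AbelianVarietyBrauerRelationInflation` §3 (CONSUMED: `card_isConj_eq_of_card_conj_mem_eq`,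
`isIsogenous_of_card_conj_mem_eq`), `Motives/AbelianVarietyBrauerRelationIsogenies` (CONSUMED:
`finrank_hom_image_eq_of_gassmann`).  "Such examples exist in abundance, and one good source of them is
`(G(𝔽_q), P_1(𝔽_q), P_2(𝔽_q))` where `G` is a reductive group over a finite field `𝔽_q`, with `P_1` and `P_2`
non-conjugate parabolic subgroups in `G` but for which their Levi subgroups are conjugate" — here, for `G = GLₙ(𝔽_q)`,
the stabilisers of a non-zero vector `v₀` and of a non-zero covector `w₀` (for `q = 2` exactly the maximal parabolics
`P_1`, `P_2` fixing a point, resp. a hyperplane, of `ℙ^{n−1}`).  The proof is the LINEAR ALGEBRA behind the example: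
(i) `GLₙ(F)` is transitive on non-zero vectors and on non-zero covectors (explicit rank-one matrices
`1 + a bᵀ`, determinant `1 + bᵀa`), so the marks are `m_{P₁}(g) = |P₁| · |{u ≠ 0 : gu = u}|`,
`m_{P₂}(g) = |P₂| · |{w ≠ 0 : wg = w}|`; (ii) `|{u : (g−1)u = 0}| = q^{n − rank(g−1)} = q^{n − rank((g−1)ᵀ)} =
|{w : w(g−1) = 0}|` (`Matrix.rank_transpose`); (iii) `|P₁| = |P₂|` (the marks at `g = 1`).  Everything is PROVED;
the file introduces NO definition and NO named fact (net Literature debt 0).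

## Sources, verbatim

D. Prasad, *A refined notion of arithmetically equivalent number fields, and curves with isomorphic Jacobians*,
Adv. Math. **312** (2017) 198–208 (arXiv 1409.3173, held text `paper:arxiv-1409.3173`), Introduction (p0002): "Call a
triple of finite groups `(G, H_1, H_2)` with `H_1` and `H_2` subgroups of `G`, a Gassmann triple, if `ℚ[G/H_1]` and
`ℚ[G/H_2]` are isomorphic as `G`-modules but `H_1` and `H_2` are not conjugate in `G`. Such examples exist in
abundance, and one good source of them is `(G(𝔽_q), P_1(𝔽_q), P_2(𝔽_q))` where `G` is a reductive group over a
finite field `𝔽_q`, with `P_1` and `P_2` non-conjugate parabolic subgroups in `G` but for which their Levi subgroups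
are conjugate; the smallest such example is therefore for `G = SL_3(𝔽_2)`, a simple group of order `168` containing
`P_1(𝔽_2)` and `P_2(𝔽_2)` as subgroups of index `7`."

D. Prasad, C. S. Rajan, *On an archimedean analogue of Tate's conjecture*, J. Number Theory **99** (2003),
arXiv:math/0203295 (held `paper:arxiv-math_0203295`), §2 (Gassmann equivalence: "`|C ∩ H_1| = |C ∩ H_2|` for all
conjugacy classes `C`"), Cor. 4.  V. Dokchitser, H. Green, A. Konstantinou, A. Morgan, arXiv 2211.06357, §1.3
Thm. 1.3 (= Kani–Rosen, Math. Ann. 284 (1989), Thm. 3): "For every Brauer relation `Θ = Σ_i H_i − Σ_j H_j'` for `G`,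
there is an isogeny `∏_j Jac_{X/H_j'} → ∏_i Jac_{X/H_i}`" (here `Θ = P₁ − P₂`).

## Dictionary and what is proved

`F` a finite field, `n` a finite index type, `G = GLₙ(F) = Matrix.GeneralLinearGroup n F` (Mathlib `GL n F`),
acting on `X` by `ρ : G →* End X`; `v₀, w₀ : n → F` non-zero; `P₁ = {A : A v₀ = v₀}` (`A *ᵥ v₀`, the stabiliser of
the vector `v₀`), `P₂ = {A : w₀ A = w₀}` (`w₀ ᵥ* A`, the stabiliser of the covector `w₀`), by MEMBERSHIP
CHARACTERISATIONS; marks `m_H(g) = |{x : x⁻¹gx ∈ H}|`; `N_i` with `End.of N_i = Σ_{h ∈ P_i} ρ h`, `B_{P_i} = Im N_i`.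

* §1 (linear algebra over a finite field) `natCard_mulVec_eq_zero` / `natCard_vecMul_eq_zero`
  (`|{v : Av = 0}| = |{w : wA = 0}| = q^{n − rank A}`), **`natCard_fixedVec_eq_natCard_fixedCovec`**
  (`|{v : Mv = v}| = |{w : wM = w}|`), `one_add_vecMulVec_mulVec`, `vecMul_one_add_vecMulVec`,
  `det_one_add_vecMulVec` (`(1 + abᵀ)u = u + (bᵀu)a`, `wᵀ(1 + abᵀ) = w + (wᵀa)b`, `det(1 + abᵀ) = 1 + bᵀa`).
* §2 (transitivity) **`exists_GL_mulVec_single_eq`**, **`exists_GL_mulVec_eq`**, **`exists_GL_vecMul_eq`**: for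
  `v₀, v ≠ 0` some `x ∈ GLₙ(F)` has `xv₀ = v`, and likewise for covectors.
* §3 (marks) `conj_mem_iff_mulVec` (`x⁻¹gx ∈ P₁ ↔ g(xv₀) = xv₀`), `mul_conj_mem_iff_vecMul`, the fibre counts
  `natCard_mulVec_fiber_eq` (`|{x : xv₀ = u}| = |P₁|` for `u ≠ 0`), `natCard_mulVec_fiber_zero`, the covector
  analogues, **`card_conj_mem_vecStabilizer`** (`m_{P₁}(g) = |P₁|·|{u ≠ 0 : gu = u}|`),
  **`card_conj_mem_covecStabilizer`** (`m_{P₂}(g) = |P₂|·|{w ≠ 0 : wg = w}|`), `natCard_fixedVec_eq_succ` /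
  `natCard_fixedCovec_eq_succ` (splitting off `0`), **`natCard_vecStabilizer_eq`** (`|P₁| = |P₂|`) and
  **`card_conj_mem_mirabolic_eq`** (`m_{P₁} = m_{P₂}`: "`ℚ[G/H_1]` and `ℚ[G/H_2]` are isomorphic as `G`-modules").
* §4 (non-conjugacy, `|n| ≥ 3`) **`mirabolic_not_conjugate`**: for every `x ∈ G` some `h ∈ P₁` has `xhx⁻¹ ∉ P₂`
  ("`H_1` and `H_2` are not conjugate in `G`"; the witness is a transvection `1 + abᵀ` with `bᵀv₀ = bᵀa = 0`,
  `(w₀x)a ≠ 0`, `b ≠ 0`, found by a dimension count).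
* §5 (any field) **`finrank_hom_image_mirabolic_eq`** (`rk Hom(B_{P₁}, B) = rk Hom(B_{P₂}, B)`); (perfect field)
  **`isIsogenous_mirabolic`** (`B_{P₁} ∼ B_{P₂}`), **`dim_mirabolic_eq`**.

Scope (stated, not hidden). (1) The subgroups are the stabilisers of a VECTOR and of a COVECTOR (for `q = 2` the
maximal parabolics of the quotation; for `q > 2` the parabolics are the stabilisers of the LINE `Fv₀` and of the
HYPERPLANE `ker w₀`, which contain `P₁`, `P₂` with index `q − 1` — that variant, equally Gassmann, is not formalised
here).  (2) `SLₙ` versus `GLₙ`: the statement is for `GLₙ(F)`.  (3) Only the rational consequence (isogeny, Hom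
counts, dimensions) — not Prasad's refined integral equivalence.  (4) Hom counts over ANY field; isogeny and
dimensions over a PERFECT field.

## References

* [Prasad2017] D. Prasad, Adv. Math. 312 (2017) 198–208, arXiv:1409.3173, Introduction.
* [PrasadRajan2003] D. Prasad, C. S. Rajan, J. Number Theory 99 (2003), arXiv:math/0203295, §2, Cor. 4.
* [KaniRosen1989] E. Kani, M. Rosen, Math. Ann. 284 (1989) 307–327, Thm. 3.
* [DokchitserEtAl2022] V. Dokchitser, H. Green, A. Konstantinou, A. Morgan, arXiv:2211.06357, §1.3 Thm. 1.3.
-/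

noncomputable section

universe u

open CategoryTheory CategoryTheory.Limits Matrix

namespace Literature.AlgebraicGeometry.Motives

namespace MirabolicGassmann

/-! ## §1 Linear algebra over a finite field: fixed vectors versus fixed covectors, rank-one updates -/

section LinearAlgebra

variable {F : Type} [Field F] {n : Type} [Fintype n]

/-- **`|{v : Av = 0}| = q^{n − rank A}`** over a finite field (rank–nullity and `|ker| = q^{dim ker}`).
[cite: Prasad2017, Introduction (the parabolic example rests on this count)] -/
theorem natCard_mulVec_eq_zero [Finite F] (A : Matrix n n F) :
    Nat.card {v : n → F // A *ᵥ v = 0} = Nat.card F ^ (Fintype.card n - A.rank) := by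
  have e : Nat.card {v : n → F // A *ᵥ v = 0} = Nat.card (LinearMap.ker A.mulVecLin) :=
    Nat.card_congr (Equiv.subtypeEquivRight fun v ↦ by rw [LinearMap.mem_ker, Matrix.mulVecLin_apply])
  rw [e, Module.natCard_eq_pow_finrank (K := F)]
  congr 1
  have h := LinearMap.finrank_range_add_finrank_ker A.mulVecLin
  rw [Module.finrank_fintype_fun_eq_card] at h
  change A.rank + _ = _ at h
  omega

/-- **`|{w : wA = 0}| = q^{n − rank A}`** (`wA = Aᵀw` and `rank Aᵀ = rank A`, Mathlib's `Matrix.rank_transpose`).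
[cite: Prasad2017, Introduction] -/
theorem natCard_vecMul_eq_zero [Finite F] (A : Matrix n n F) :
    Nat.card {w : n → F // w ᵥ* A = 0} = Nat.card F ^ (Fintype.card n - A.rank) := by
  rw [← Matrix.rank_transpose, ← natCard_mulVec_eq_zero]
  exact Nat.card_congr (Equiv.subtypeEquivRight fun w ↦ by rw [Matrix.mulVec_transpose])

variable [DecidableEq n]

/-- **A square matrix over a finite field fixes as many vectors as covectors**: `|{v : Mv = v}| = |{w : wM = w}|`
(both `q^{n − rank(M − 1)}`). [cite: Prasad2017, Introduction ("ℚ[G/H_1] and ℚ[G/H_2] are isomorphic")] -/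
theorem natCard_fixedVec_eq_natCard_fixedCovec [Finite F] (M : Matrix n n F) :
    Nat.card {v : n → F // M *ᵥ v = v} = Nat.card {w : n → F // w ᵥ* M = w} := by
  have h1 : Nat.card {v : n → F // M *ᵥ v = v} = Nat.card {v : n → F // (M - 1) *ᵥ v = 0} :=
    Nat.card_congr (Equiv.subtypeEquivRight fun v ↦ by rw [Matrix.sub_mulVec, Matrix.one_mulVec, sub_eq_zero])
  have h2 : Nat.card {w : n → F // w ᵥ* M = w} = Nat.card {w : n → F // w ᵥ* (M - 1) = 0} :=
    Nat.card_congr (Equiv.subtypeEquivRight fun w ↦ by rw [Matrix.vecMul_sub, Matrix.vecMul_one, sub_eq_zero])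
  rw [h1, h2, natCard_mulVec_eq_zero, natCard_vecMul_eq_zero]

/-- The rank-one update on vectors: `(1 + abᵀ)u = u + (bᵀu)a`. [folklore] -/
private theorem one_add_vecMulVec_mulVec (a b u : n → F) :
    (1 + Matrix.vecMulVec a b) *ᵥ u = u + (b ⬝ᵥ u) • a := by
  rw [Matrix.add_mulVec, Matrix.one_mulVec, Matrix.vecMulVec_mulVec, op_smul_eq_smul]

/-- The rank-one update on covectors: `wᵀ(1 + abᵀ) = wᵀ + (wᵀa)bᵀ`. [folklore] -/
private theorem vecMul_one_add_vecMulVec (a b w : n → F) :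
    w ᵥ* (1 + Matrix.vecMulVec a b) = w + (w ⬝ᵥ a) • b := by
  rw [Matrix.vecMul_add, Matrix.vecMul_one, Matrix.vecMul_vecMulVec]

/-- The matrix determinant lemma for `1 + abᵀ`: `det(1 + abᵀ) = 1 + bᵀa` (Mathlib's
`det_one_add_replicateCol_mul_replicateRow`). [folklore] -/
private theorem det_one_add_vecMulVec (a b : n → F) : (1 + Matrix.vecMulVec a b).det = 1 + b ⬝ᵥ a := by
  rw [Matrix.vecMulVec_eq Unit, Matrix.det_one_add_replicateCol_mul_replicateRow]

end LinearAlgebra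

/-! ## §2 `GLₙ(F)` is transitive on non-zero vectors and on non-zero covectors -/

section Transitivity

variable {F : Type} [Field F] {n : Type} [Fintype n] [DecidableEq n]

/-- **A matrix in `GLₙ(F)` sending `e_{i₀}` to a given non-zero `v`** — a product of at most two rank-one updates
`1 + abᵀ` with determinants `v_{i₀}` resp. `1` and `v_i`. [cite: Prasad2017, Introduction (G transitive on points)] -/
theorem exists_GL_mulVec_single_eq (i₀ : n) {v : n → F} (hv : v ≠ 0) :
    ∃ x : GL n F, (x : Matrix n n F) *ᵥ Pi.single i₀ 1 = v := by
  obtain ⟨i, hi⟩ := Function.ne_iff.1 hv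
  by_cases h0 : v i₀ ≠ 0
  · have hdet : (1 + Matrix.vecMulVec (v - Pi.single i₀ 1) (Pi.single i₀ (1 : F))).det ≠ 0 := by
      rw [det_one_add_vecMulVec, single_dotProduct, one_mul, Pi.sub_apply, Pi.single_eq_same,
        add_sub_cancel]
      exact h0
    refine ⟨Matrix.GeneralLinearGroup.mkOfDetNeZero _ hdet, ?_⟩
    change (1 + Matrix.vecMulVec (v - Pi.single i₀ 1) (Pi.single i₀ (1 : F))) *ᵥ Pi.single i₀ 1 = v
    rw [one_add_vecMulVec_mulVec, single_dotProduct, one_mul, Pi.single_eq_same, one_smul, add_sub_cancel]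
  · have h0 : v i₀ = 0 := not_ne_iff.1 h0
    have hii : i ≠ i₀ := fun h ↦ hi (h ▸ h0)
    have hdetT : (1 + Matrix.vecMulVec (Pi.single i (1 : F)) (Pi.single i₀ (1 : F))).det ≠ 0 := by
      rw [det_one_add_vecMulVec, single_dotProduct, one_mul, Pi.single_eq_of_ne hii.symm, add_zero]
      exact one_ne_zero
    have hu : (Pi.single i₀ (1 : F) + Pi.single i (1 : F) : n → F) i = 1 := by
      rw [Pi.add_apply, Pi.single_eq_of_ne hii, Pi.single_eq_same, zero_add]
    have hdetM : (1 + Matrix.vecMulVec (v - (Pi.single i₀ 1 + Pi.single i 1)) (Pi.single i (1 : F))).det ≠ 0 := by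
      rw [det_one_add_vecMulVec, single_dotProduct, one_mul, Pi.sub_apply, hu, add_sub_cancel]
      exact hi
    have hT : (1 + Matrix.vecMulVec (Pi.single i (1 : F)) (Pi.single i₀ (1 : F))) *ᵥ Pi.single i₀ 1 =
        Pi.single i₀ 1 + Pi.single i 1 := by
      rw [one_add_vecMulVec_mulVec, single_dotProduct, one_mul, Pi.single_eq_same, one_smul]
    refine ⟨Matrix.GeneralLinearGroup.mkOfDetNeZero _ hdetM * Matrix.GeneralLinearGroup.mkOfDetNeZero _ hdetT,
      ?_⟩
    rw [Matrix.GeneralLinearGroup.coe_mul, ← Matrix.mulVec_mulVec]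
    change (1 + Matrix.vecMulVec (v - (Pi.single i₀ 1 + Pi.single i 1)) (Pi.single i (1 : F))) *ᵥ
      ((1 + Matrix.vecMulVec (Pi.single i (1 : F)) (Pi.single i₀ (1 : F))) *ᵥ Pi.single i₀ 1) = v
    rw [hT, one_add_vecMulVec_mulVec, single_dotProduct, one_mul, hu, one_smul, add_sub_cancel]

/-- **`GLₙ(F)` is transitive on non-zero vectors**: for `v₀, v ≠ 0` some `x` has `xv₀ = v`.
[cite: Prasad2017, Introduction] -/
theorem exists_GL_mulVec_eq {v₀ v : n → F} (hv₀ : v₀ ≠ 0) (hv : v ≠ 0) :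
    ∃ x : GL n F, (x : Matrix n n F) *ᵥ v₀ = v := by
  obtain ⟨i₀, -⟩ := Function.ne_iff.1 hv₀
  obtain ⟨y, hy⟩ := exists_GL_mulVec_single_eq i₀ hv₀
  obtain ⟨z, hz⟩ := exists_GL_mulVec_single_eq i₀ hv
  refine ⟨z * y⁻¹, ?_⟩
  rw [Matrix.GeneralLinearGroup.coe_mul, ← Matrix.mulVec_mulVec, ← hz, ← hy,
    Matrix.mulVec_mulVec (Pi.single i₀ 1) ((y⁻¹ : GL n F) : Matrix n n F) (y : Matrix n n F), Units.inv_mul,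
    Matrix.one_mulVec]

/-- **`GLₙ(F)` is transitive on non-zero covectors**: for `w₀, w ≠ 0` some `x` has `w₀x = w` (transpose).
[cite: Prasad2017, Introduction] -/
theorem exists_GL_vecMul_eq {w₀ w : n → F} (hw₀ : w₀ ≠ 0) (hw : w ≠ 0) :
    ∃ x : GL n F, w₀ ᵥ* (x : Matrix n n F) = w := by
  obtain ⟨y, hy⟩ := exists_GL_mulVec_eq hw₀ hw
  have hdet : ((y : Matrix n n F)ᵀ).det ≠ 0 := by
    rw [Matrix.det_transpose]
    exact (Matrix.isUnits_det_units y).ne_zero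
  refine ⟨Matrix.GeneralLinearGroup.mkOfDetNeZero _ hdet, ?_⟩
  change w₀ ᵥ* (y : Matrix n n F)ᵀ = w
  rw [Matrix.vecMul_transpose, hy]

end Transitivity

/-! ## §3 The marks of the two stabilisers -/

section Marks

variable {F : Type} [Field F] {n : Type} [Fintype n] [DecidableEq n]

/-- **Conjugates in the vector stabiliser**: if `A ∈ P ↔ Av₀ = v₀` then `x⁻¹gx ∈ P ↔ g(xv₀) = xv₀`.
[cite: PrasadRajan2003, §2 (Gassmann equivalence via the G-sets G/H_i)] -/
theorem conj_mem_iff_mulVec (P : Subgroup (GL n F)) (v₀ : n → F)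
    (hP : ∀ A : GL n F, A ∈ P ↔ (A : Matrix n n F) *ᵥ v₀ = v₀) (g x : GL n F) :
    x⁻¹ * g * x ∈ P ↔ (g : Matrix n n F) *ᵥ ((x : Matrix n n F) *ᵥ v₀) = (x : Matrix n n F) *ᵥ v₀ := by
  rw [hP, Matrix.GeneralLinearGroup.coe_mul, Matrix.GeneralLinearGroup.coe_mul, Matrix.mulVec_mulVec]
  constructor
  · intro h
    have h' := congrArg (fun w ↦ (x : Matrix n n F) *ᵥ w) h
    simp only [Matrix.mulVec_mulVec, ← mul_assoc, Units.mul_inv, one_mul] at h'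
    exact h'
  · intro h
    have h' := congrArg (fun w ↦ ((x⁻¹ : GL n F) : Matrix n n F) *ᵥ w) h
    simp only [Matrix.mulVec_mulVec, ← mul_assoc, Units.inv_mul, Matrix.one_mulVec] at h'
    exact h'

/-- **Conjugates in the covector stabiliser**: if `A ∈ P ↔ w₀A = w₀` then `xgx⁻¹ ∈ P ↔ (w₀x)g = w₀x`.
[cite: PrasadRajan2003, §2] -/
theorem mul_conj_mem_iff_vecMul (P : Subgroup (GL n F)) (w₀ : n → F)
    (hP : ∀ A : GL n F, A ∈ P ↔ w₀ ᵥ* (A : Matrix n n F) = w₀) (g x : GL n F) :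
    x * g * x⁻¹ ∈ P ↔ (w₀ ᵥ* (x : Matrix n n F)) ᵥ* (g : Matrix n n F) = w₀ ᵥ* (x : Matrix n n F) := by
  rw [hP, Matrix.GeneralLinearGroup.coe_mul, Matrix.GeneralLinearGroup.coe_mul, Matrix.vecMul_vecMul]
  constructor
  · intro h
    have h' := congrArg (fun w ↦ w ᵥ* (x : Matrix n n F)) h
    simp only [Matrix.vecMul_vecMul, mul_assoc, Units.inv_mul, mul_one] at h'
    exact h'
  · intro h
    have h' := congrArg (fun w ↦ w ᵥ* ((x⁻¹ : GL n F) : Matrix n n F)) h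
    simp only [Matrix.vecMul_vecMul, mul_assoc, Units.mul_inv, Matrix.vecMul_one] at h'
    rw [← mul_assoc] at h'
    exact h'

/-- **The fibres of `x ↦ xv₀` are cosets of `P₁`**: if `x₀v₀ = u` then `|{x : xv₀ = u}| = |P₁|`.
[cite: PrasadRajan2003, §2] -/
theorem natCard_mulVec_fiber_eq (P : Subgroup (GL n F)) {v₀ : n → F}
    (hP : ∀ A : GL n F, A ∈ P ↔ (A : Matrix n n F) *ᵥ v₀ = v₀) {x₀ : GL n F} {u : n → F}
    (hx₀ : (x₀ : Matrix n n F) *ᵥ v₀ = u) :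
    Nat.card {x : GL n F // (x : Matrix n n F) *ᵥ v₀ = u} = Nat.card P := by
  have hinv : ((x₀⁻¹ : GL n F) : Matrix n n F) *ᵥ u = v₀ := by
    rw [← hx₀, Matrix.mulVec_mulVec, Units.inv_mul, Matrix.one_mulVec]
  refine Nat.card_congr
    { toFun := fun x ↦ ⟨x₀⁻¹ * x.1, (hP _).2 (by
        rw [Matrix.GeneralLinearGroup.coe_mul, ← Matrix.mulVec_mulVec, x.2, hinv])⟩
      invFun := fun p ↦ ⟨x₀ * p.1, by
        rw [Matrix.GeneralLinearGroup.coe_mul, ← Matrix.mulVec_mulVec, (hP _).1 p.2, hx₀]⟩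
      left_inv := fun x ↦ Subtype.ext (mul_inv_cancel_left x₀ x.1)
      right_inv := fun p ↦ Subtype.ext (inv_mul_cancel_left x₀ p.1) }

/-- Over the zero vector the fibre is empty: `xv₀ ≠ 0` for invertible `x` and `v₀ ≠ 0`. [folklore] -/
private theorem natCard_mulVec_fiber_zero {v₀ : n → F} (hv₀ : v₀ ≠ 0) :
    Nat.card {x : GL n F // (x : Matrix n n F) *ᵥ v₀ = 0} = 0 := by
  rw [Nat.card_eq_zero]
  refine Or.inl ⟨fun x ↦ hv₀ ?_⟩
  have h := congrArg (fun w ↦ ((x.1⁻¹ : GL n F) : Matrix n n F) *ᵥ w) x.2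
  simpa only [Matrix.mulVec_mulVec, Units.inv_mul, Matrix.one_mulVec, Matrix.mulVec_zero] using h

/-- **The fibres of `x ↦ w₀x` are cosets of `P₂`**: if `w₀x₀ = w` then `|{x : w₀x = w}| = |P₂|`.
[cite: PrasadRajan2003, §2] -/
theorem natCard_vecMul_fiber_eq (P : Subgroup (GL n F)) {w₀ : n → F}
    (hP : ∀ A : GL n F, A ∈ P ↔ w₀ ᵥ* (A : Matrix n n F) = w₀) {x₀ : GL n F} {w : n → F}
    (hx₀ : w₀ ᵥ* (x₀ : Matrix n n F) = w) :
    Nat.card {x : GL n F // w₀ ᵥ* (x : Matrix n n F) = w} = Nat.card P := by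
  have hinv : w ᵥ* ((x₀⁻¹ : GL n F) : Matrix n n F) = w₀ := by
    rw [← hx₀, Matrix.vecMul_vecMul, Units.mul_inv, Matrix.vecMul_one]
  refine Nat.card_congr
    { toFun := fun x ↦ ⟨x.1 * x₀⁻¹, (hP _).2 (by
        rw [Matrix.GeneralLinearGroup.coe_mul, ← Matrix.vecMul_vecMul, x.2, hinv])⟩
      invFun := fun p ↦ ⟨p.1 * x₀, by
        rw [Matrix.GeneralLinearGroup.coe_mul, ← Matrix.vecMul_vecMul, (hP _).1 p.2, hx₀]⟩
      left_inv := fun x ↦ Subtype.ext (inv_mul_cancel_right x.1 x₀)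
      right_inv := fun p ↦ Subtype.ext (mul_inv_cancel_right p.1 x₀) }

/-- Over the zero covector the fibre is empty. [folklore] -/
private theorem natCard_vecMul_fiber_zero {w₀ : n → F} (hw₀ : w₀ ≠ 0) :
    Nat.card {x : GL n F // w₀ ᵥ* (x : Matrix n n F) = 0} = 0 := by
  rw [Nat.card_eq_zero]
  refine Or.inl ⟨fun x ↦ hw₀ ?_⟩
  have h := congrArg (fun w ↦ w ᵥ* ((x.1⁻¹ : GL n F) : Matrix n n F)) x.2
  simpa only [Matrix.vecMul_vecMul, Units.mul_inv, Matrix.vecMul_one, Matrix.zero_vecMul] using h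

/-- Transfer of counts to decidable predicates. [folklore] -/
private theorem natCard_subtype_eq_card_filter {α : Type} [Fintype α] (P : α → Prop) [DecidablePred P]
    (Q : α → Prop) (hQP : ∀ x, Q x ↔ P x) : Nat.card {x : α // Q x} = (Finset.univ.filter P).card := by
  rw [← Fintype.card_subtype, ← Nat.card_eq_fintype_card]
  exact Nat.card_congr (Equiv.subtypeEquivRight hQP)

/-- Counting through a map, fibre by fibre: `|{a : Q(φ a)}| = Σ_{b : Q b} |{a : φ a = b}|`. [folklore] -/
private theorem natCard_comp_eq_sum {α β : Type} [Fintype α] [Fintype β] [DecidableEq β] (φ : α → β)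
    (Q : β → Prop) [DecidablePred Q] :
    Nat.card {a : α // Q (φ a)} = ∑ b ∈ Finset.univ.filter Q, Nat.card {a : α // φ a = b} := by
  classical
  rw [natCard_subtype_eq_card_filter (fun a ↦ Q (φ a)) _ (fun _ ↦ Iff.rfl),
    Finset.card_eq_sum_card_fiberwise (f := φ) (s := Finset.univ.filter fun a ↦ Q (φ a))
      (t := Finset.univ.filter Q) fun a ha ↦ by
        simp only [Finset.coe_filter, Finset.mem_univ, true_and, Set.mem_setOf_eq] at ha ⊢
        exact ha]
  refine Finset.sum_congr rfl fun b hb ↦ ?_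
  have hb' : Q b := (Finset.mem_filter.1 hb).2
  rw [natCard_subtype_eq_card_filter (fun a ↦ φ a = b) _ (fun _ ↦ Iff.rfl)]
  congr 1
  ext a
  simp only [Finset.mem_filter, Finset.mem_univ, true_and]
  exact ⟨fun h ↦ h.2, fun h ↦ ⟨by rw [h]; exact hb', h⟩⟩

variable [Fintype F] [DecidableEq F]

/-- **The marks of the vector stabiliser**: for `v₀ ≠ 0` and `A ∈ P₁ ↔ Av₀ = v₀`,
`m_{P₁}(g) = |{x : x⁻¹gx ∈ P₁}| = |P₁| · |{u ≠ 0 : gu = u}|` (sort the `x` by the non-zero vector `u = xv₀`).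
[cite: PrasadRajan2003, §2] [cite: Prasad2017, Introduction] -/
theorem card_conj_mem_vecStabilizer (P₁ : Subgroup (GL n F)) {v₀ : n → F} (hv₀ : v₀ ≠ 0)
    (hP₁ : ∀ A : GL n F, A ∈ P₁ ↔ (A : Matrix n n F) *ᵥ v₀ = v₀) (g : GL n F) :
    Nat.card {x : GL n F // x⁻¹ * g * x ∈ P₁} =
      Nat.card P₁ * Nat.card {u : n → F // u ≠ 0 ∧ (g : Matrix n n F) *ᵥ u = u} := by
  classical
  calc Nat.card {x : GL n F // x⁻¹ * g * x ∈ P₁}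
      = Nat.card {x : GL n F // (g : Matrix n n F) *ᵥ ((x : Matrix n n F) *ᵥ v₀) = (x : Matrix n n F) *ᵥ v₀} :=
        Nat.card_congr (Equiv.subtypeEquivRight (conj_mem_iff_mulVec P₁ v₀ hP₁ g))
    _ = ∑ u ∈ Finset.univ.filter (fun u : n → F ↦ (g : Matrix n n F) *ᵥ u = u),
          Nat.card {x : GL n F // (x : Matrix n n F) *ᵥ v₀ = u} :=
        natCard_comp_eq_sum (fun x : GL n F ↦ (x : Matrix n n F) *ᵥ v₀) (fun u ↦ (g : Matrix n n F) *ᵥ u = u)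
    _ = ∑ u ∈ Finset.univ.filter (fun u : n → F ↦ (g : Matrix n n F) *ᵥ u = u),
          (if u = 0 then 0 else Nat.card P₁) := Finset.sum_congr rfl fun u _ ↦ by
        split_ifs with hu
        · rw [hu]
          exact natCard_mulVec_fiber_zero hv₀
        · obtain ⟨x₀, hx₀⟩ := exists_GL_mulVec_eq hv₀ hu
          exact natCard_mulVec_fiber_eq P₁ hP₁ hx₀
    _ = Nat.card P₁ * ((Finset.univ.filter fun u : n → F ↦ (g : Matrix n n F) *ᵥ u = u).filter
          fun u ↦ ¬u = 0).card := by
        rw [Finset.sum_ite, Finset.sum_const_zero, zero_add, Finset.sum_const, smul_eq_mul, mul_comm]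
    _ = Nat.card P₁ * Nat.card {u : n → F // u ≠ 0 ∧ (g : Matrix n n F) *ᵥ u = u} := by
        rw [Finset.filter_filter, natCard_subtype_eq_card_filter
          (fun u : n → F ↦ (g : Matrix n n F) *ᵥ u = u ∧ ¬u = 0) _ (fun u ↦ and_comm)]

/-- **The marks of the covector stabiliser**: for `w₀ ≠ 0` and `A ∈ P₂ ↔ w₀A = w₀`,
`m_{P₂}(g) = |{x : x⁻¹gx ∈ P₂}| = |{x : xgx⁻¹ ∈ P₂}| = |P₂| · |{w ≠ 0 : wg = w}|`.
[cite: PrasadRajan2003, §2] [cite: Prasad2017, Introduction] -/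
theorem card_conj_mem_covecStabilizer (P₂ : Subgroup (GL n F)) {w₀ : n → F} (hw₀ : w₀ ≠ 0)
    (hP₂ : ∀ A : GL n F, A ∈ P₂ ↔ w₀ ᵥ* (A : Matrix n n F) = w₀) (g : GL n F) :
    Nat.card {x : GL n F // x⁻¹ * g * x ∈ P₂} =
      Nat.card P₂ * Nat.card {w : n → F // w ≠ 0 ∧ w ᵥ* (g : Matrix n n F) = w} := by
  classical
  calc Nat.card {x : GL n F // x⁻¹ * g * x ∈ P₂}
      = Nat.card {x : GL n F // x * g * x⁻¹ ∈ P₂} :=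
        Nat.card_congr (Equiv.subtypeEquiv (Equiv.inv (GL n F)) fun x ↦ by rw [Equiv.inv_apply, inv_inv])
    _ = Nat.card {x : GL n F // (w₀ ᵥ* (x : Matrix n n F)) ᵥ* (g : Matrix n n F) = w₀ ᵥ* (x : Matrix n n F)} :=
        Nat.card_congr (Equiv.subtypeEquivRight (mul_conj_mem_iff_vecMul P₂ w₀ hP₂ g))
    _ = ∑ w ∈ Finset.univ.filter (fun w : n → F ↦ w ᵥ* (g : Matrix n n F) = w),
          Nat.card {x : GL n F // w₀ ᵥ* (x : Matrix n n F) = w} :=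
        natCard_comp_eq_sum (fun x : GL n F ↦ w₀ ᵥ* (x : Matrix n n F)) (fun w ↦ w ᵥ* (g : Matrix n n F) = w)
    _ = ∑ w ∈ Finset.univ.filter (fun w : n → F ↦ w ᵥ* (g : Matrix n n F) = w),
          (if w = 0 then 0 else Nat.card P₂) := Finset.sum_congr rfl fun w _ ↦ by
        split_ifs with hw
        · rw [hw]
          exact natCard_vecMul_fiber_zero hw₀
        · obtain ⟨x₀, hx₀⟩ := exists_GL_vecMul_eq hw₀ hw
          exact natCard_vecMul_fiber_eq P₂ hP₂ hx₀
    _ = Nat.card P₂ * ((Finset.univ.filter fun w : n → F ↦ w ᵥ* (g : Matrix n n F) = w).filter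
          fun w ↦ ¬w = 0).card := by
        rw [Finset.sum_ite, Finset.sum_const_zero, zero_add, Finset.sum_const, smul_eq_mul, mul_comm]
    _ = Nat.card P₂ * Nat.card {w : n → F // w ≠ 0 ∧ w ᵥ* (g : Matrix n n F) = w} := by
        rw [Finset.filter_filter, natCard_subtype_eq_card_filter
          (fun w : n → F ↦ w ᵥ* (g : Matrix n n F) = w ∧ ¬w = 0) _ (fun w ↦ and_comm)]

/-- Splitting off the zero vector: `|{u : Mu = u}| = |{u ≠ 0 : Mu = u}| + 1`. [folklore] -/
private theorem natCard_fixedVec_eq_succ (M : Matrix n n F) :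
    Nat.card {u : n → F // M *ᵥ u = u} = Nat.card {u : n → F // u ≠ 0 ∧ M *ᵥ u = u} + 1 := by
  classical
  rw [natCard_subtype_eq_card_filter (fun u : n → F ↦ M *ᵥ u = u) _ (fun _ ↦ Iff.rfl),
    natCard_subtype_eq_card_filter (fun u : n → F ↦ u ≠ 0 ∧ M *ᵥ u = u) _ (fun _ ↦ Iff.rfl),
    ← Finset.card_filter_add_card_filter_not (s := Finset.univ.filter fun u : n → F ↦ M *ᵥ u = u)
      (fun u : n → F ↦ u ≠ 0), Finset.filter_filter, Finset.filter_filter]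
  congr 1
  · exact congrArg Finset.card (Finset.filter_congr fun u _ ↦ and_comm)
  · rw [Finset.card_eq_one]
    refine ⟨0, Finset.ext fun u ↦ ?_⟩
    simp only [Finset.mem_filter, Finset.mem_univ, true_and, ne_eq, not_not, Finset.mem_singleton]
    exact ⟨fun h ↦ h.2, fun h ↦ ⟨by rw [h, Matrix.mulVec_zero], h⟩⟩

/-- Splitting off the zero covector: `|{w : wM = w}| = |{w ≠ 0 : wM = w}| + 1`. [folklore] -/
private theorem natCard_fixedCovec_eq_succ (M : Matrix n n F) :
    Nat.card {w : n → F // w ᵥ* M = w} = Nat.card {w : n → F // w ≠ 0 ∧ w ᵥ* M = w} + 1 := by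
  classical
  rw [natCard_subtype_eq_card_filter (fun w : n → F ↦ w ᵥ* M = w) _ (fun _ ↦ Iff.rfl),
    natCard_subtype_eq_card_filter (fun w : n → F ↦ w ≠ 0 ∧ w ᵥ* M = w) _ (fun _ ↦ Iff.rfl),
    ← Finset.card_filter_add_card_filter_not (s := Finset.univ.filter fun w : n → F ↦ w ᵥ* M = w)
      (fun w : n → F ↦ w ≠ 0), Finset.filter_filter, Finset.filter_filter]
  congr 1
  · exact congrArg Finset.card (Finset.filter_congr fun w _ ↦ and_comm)
  · rw [Finset.card_eq_one]
    refine ⟨0, Finset.ext fun w ↦ ?_⟩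
    simp only [Finset.mem_filter, Finset.mem_univ, true_and, ne_eq, not_not, Finset.mem_singleton]
    exact ⟨fun h ↦ h.2, fun h ↦ ⟨by rw [h, Matrix.zero_vecMul], h⟩⟩

/-- **`g` fixes as many non-zero vectors as non-zero covectors.** [cite: Prasad2017, Introduction] -/
theorem natCard_fixedVec_ne_zero_eq (M : Matrix n n F) :
    Nat.card {u : n → F // u ≠ 0 ∧ M *ᵥ u = u} = Nat.card {w : n → F // w ≠ 0 ∧ w ᵥ* M = w} := by
  have h := natCard_fixedVec_eq_natCard_fixedCovec M
  rw [natCard_fixedVec_eq_succ, natCard_fixedCovec_eq_succ] at h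
  omega

/-- **`|P₁| = |P₂|`** (both have index `q^n − 1`: the marks at `g = 1` are `|G| = |P_i| · (q^n − 1)`).
[cite: Prasad2017, Introduction ("subgroups of index 7" for n = 3, q = 2)] -/
theorem natCard_vecStabilizer_eq (P₁ P₂ : Subgroup (GL n F)) {v₀ w₀ : n → F} (hv₀ : v₀ ≠ 0) (hw₀ : w₀ ≠ 0)
    (hP₁ : ∀ A : GL n F, A ∈ P₁ ↔ (A : Matrix n n F) *ᵥ v₀ = v₀)
    (hP₂ : ∀ A : GL n F, A ∈ P₂ ↔ w₀ ᵥ* (A : Matrix n n F) = w₀) : Nat.card P₁ = Nat.card P₂ := by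
  have h₁ := card_conj_mem_vecStabilizer P₁ hv₀ hP₁ 1
  have h₂ := card_conj_mem_covecStabilizer P₂ hw₀ hP₂ 1
  have hall : ∀ (P : Subgroup (GL n F)), Nat.card {x : GL n F // x⁻¹ * 1 * x ∈ P} = Nat.card (GL n F) := fun P ↦
    Nat.card_congr (Equiv.subtypeUnivEquiv fun x ↦ by rw [mul_one, inv_mul_cancel]; exact P.one_mem)
  rw [hall] at h₁ h₂
  have hN : Nat.card {u : n → F // u ≠ 0 ∧ ((1 : GL n F) : Matrix n n F) *ᵥ u = u} =
      Nat.card {w : n → F // w ≠ 0 ∧ w ᵥ* ((1 : GL n F) : Matrix n n F) = w} := natCard_fixedVec_ne_zero_eq _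
  have hpos : 0 < Nat.card {u : n → F // u ≠ 0 ∧ ((1 : GL n F) : Matrix n n F) *ᵥ u = u} :=
    Nat.card_pos_iff.2 ⟨⟨⟨v₀, hv₀, by rw [Units.val_one, Matrix.one_mulVec]⟩⟩, inferInstance⟩
  rw [hN] at h₁ hpos
  exact Nat.eq_of_mul_eq_mul_right hpos (h₁.symm.trans h₂)

/-- **The mirabolic Gassmann pair: equal marks.**  For `v₀, w₀ ≠ 0`, `P₁ = Stab(v₀)`, `P₂ = Stab(w₀)` (covector):
`|{x : x⁻¹gx ∈ P₁}| = |{x : x⁻¹gx ∈ P₂}|` for every `g ∈ GLₙ(F)` — the permutation representations of `GLₙ(𝔽_q)` on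
non-zero vectors and on non-zero covectors are isomorphic ("`ℚ[G/H_1]` and `ℚ[G/H_2]` are isomorphic as
`G`-modules"). [cite: Prasad2017, Introduction] [cite: PrasadRajan2003, §2] -/
theorem card_conj_mem_mirabolic_eq (P₁ P₂ : Subgroup (GL n F)) {v₀ w₀ : n → F} (hv₀ : v₀ ≠ 0) (hw₀ : w₀ ≠ 0)
    (hP₁ : ∀ A : GL n F, A ∈ P₁ ↔ (A : Matrix n n F) *ᵥ v₀ = v₀)
    (hP₂ : ∀ A : GL n F, A ∈ P₂ ↔ w₀ ᵥ* (A : Matrix n n F) = w₀) (g : GL n F) :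
    Nat.card {x : GL n F // x⁻¹ * g * x ∈ P₁} = Nat.card {x : GL n F // x⁻¹ * g * x ∈ P₂} := by
  rw [card_conj_mem_vecStabilizer P₁ hv₀ hP₁, card_conj_mem_covecStabilizer P₂ hw₀ hP₂,
    natCard_vecStabilizer_eq P₁ P₂ hv₀ hw₀ hP₁ hP₂, natCard_fixedVec_ne_zero_eq]

end Marks

/-! ## §4 Non-conjugacy for `n ≥ 3` -/

section NotConjugate

variable {F : Type} [Field F] {n : Type} [Fintype n] [DecidableEq n]

omit [DecidableEq n] in
/-- A non-zero common zero of two linear forms `b ↦ bᵀv₀`, `b ↦ bᵀa` exists as soon as `n ≥ 3` (the kernel of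
`b ↦ (bᵀv₀, bᵀa) : Fⁿ → F²` has dimension `≥ n − 2 ≥ 1`). [folklore] -/
private theorem exists_ne_zero_dotProduct_eq_zero (hn : 3 ≤ Fintype.card n) (v₀ a : n → F) :
    ∃ b : n → F, b ≠ 0 ∧ b ⬝ᵥ v₀ = 0 ∧ b ⬝ᵥ a = 0 := by
  let f : (n → F) →ₗ[F] F × F :=
    { toFun := fun b ↦ (b ⬝ᵥ v₀, b ⬝ᵥ a)
      map_add' := fun b c ↦ by simp only [add_dotProduct, Prod.mk_add_mk]
      map_smul' := fun c b ↦ by simp only [smul_dotProduct, RingHom.id_apply, Prod.smul_mk] }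
  have hker : 0 < Module.finrank F (LinearMap.ker f) := by
    have h := LinearMap.finrank_range_add_finrank_ker f
    rw [Module.finrank_fintype_fun_eq_card] at h
    have hr : Module.finrank F (LinearMap.range f) ≤ 2 := by
      calc Module.finrank F (LinearMap.range f) ≤ Module.finrank F (F × F) := Submodule.finrank_le _
        _ = 2 := by rw [Module.finrank_prod, Module.finrank_self]
    omega
  obtain ⟨⟨b, hb⟩, hne⟩ := (Module.finrank_pos_iff_exists_ne_zero (R := F) (M := LinearMap.ker f)).1 hker
  have hb0 : b ≠ 0 := fun h0 ↦ hne (Subtype.ext h0)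
  rw [LinearMap.mem_ker] at hb
  exact ⟨b, hb0, (Prod.mk.inj hb).1, (Prod.mk.inj hb).2⟩

/-- **`P₁` and `P₂` are not conjugate (`n ≥ 3`)**: for every `x ∈ GLₙ(F)` some `h ∈ P₁ = Stab(v₀)` has
`xhx⁻¹ ∉ P₂ = Stab(w₀)` — the transvection `h = 1 + abᵀ` with `bᵀv₀ = bᵀa = 0`, `b ≠ 0` and `(w₀x)a ≠ 0` fixes `v₀`,
has determinant `1`, and moves the covector `w₀x`. [cite: Prasad2017, Introduction ("H_1 and H_2 are not conjugate in G")] -/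
theorem mirabolic_not_conjugate (hn : 3 ≤ Fintype.card n) (P₁ P₂ : Subgroup (GL n F)) {v₀ w₀ : n → F}
    (hw₀ : w₀ ≠ 0) (hP₁ : ∀ A : GL n F, A ∈ P₁ ↔ (A : Matrix n n F) *ᵥ v₀ = v₀)
    (hP₂ : ∀ A : GL n F, A ∈ P₂ ↔ w₀ ᵥ* (A : Matrix n n F) = w₀) (x : GL n F) :
    ∃ h ∈ P₁, x * h * x⁻¹ ∉ P₂ := by
  -- the covector `w = w₀ x` is non-zero; pick `a` with `wᵀ a ≠ 0`
  have hw : w₀ ᵥ* (x : Matrix n n F) ≠ 0 := by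
    intro h0
    have h1 := congrArg (fun w ↦ w ᵥ* ((x⁻¹ : GL n F) : Matrix n n F)) h0
    simp only [Matrix.vecMul_vecMul, Units.mul_inv, Matrix.vecMul_one, Matrix.zero_vecMul] at h1
    exact hw₀ h1
  obtain ⟨j, hj⟩ := Function.ne_iff.1 hw
  obtain ⟨b, hb0, hbv, hba⟩ := exists_ne_zero_dotProduct_eq_zero hn v₀ (Pi.single j (1 : F))
  have hdet : (1 + Matrix.vecMulVec (Pi.single j (1 : F)) b).det ≠ 0 := by
    rw [det_one_add_vecMulVec, hba, add_zero]
    exact one_ne_zero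
  refine ⟨Matrix.GeneralLinearGroup.mkOfDetNeZero _ hdet, (hP₁ _).2 ?_, fun hmem ↦ ?_⟩
  · change (1 + Matrix.vecMulVec (Pi.single j (1 : F)) b) *ᵥ v₀ = v₀
    rw [one_add_vecMulVec_mulVec, hbv, zero_smul, add_zero]
  · have h := (mul_conj_mem_iff_vecMul P₂ w₀ hP₂ _ x).1 hmem
    change (w₀ ᵥ* (x : Matrix n n F)) ᵥ* (1 + Matrix.vecMulVec (Pi.single j (1 : F)) b) =
      w₀ ᵥ* (x : Matrix n n F) at h
    rw [vecMul_one_add_vecMulVec, add_eq_left, dotProduct_single, mul_one, smul_eq_zero] at h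
    exact h.elim hj hb0

end NotConjugate

end MirabolicGassmann

namespace AbelianVariety

/-! ## §5 `B_{P₁} ∼ B_{P₂}` for every abelian variety with a `GLₙ(𝔽_q)`-action -/

section MirabolicGassmannAV

open MirabolicGassmann

variable {K : Type u} [Field K] {X : AbelianVariety K} {F : Type} [Field F] [Fintype F] [DecidableEq F]
  {n : Type} [Fintype n] [DecidableEq n] (ρ : GL n F →* End X) (P₁ P₂ : Subgroup (GL n F))
  [Fintype P₁] [Fintype P₂] {v₀ w₀ : n → F} {N₁ N₂ : X ⟶ X}

/-- **Equal Hom counts for the mirabolic pair** (any field): for an action of `GLₙ(𝔽_q)` on `X`, `P₁ = Stab(v₀)`,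
`P₂ = Stab(w₀)` (`v₀, w₀ ≠ 0`) and every `B`: **`rk Hom(B_{P₁}, B) = rk Hom(B_{P₂}, B)`**.
[cite: Prasad2017, Introduction] [cite: PrasadRajan2003, Cor. 4] [cite: KaniRosen1989, Thm. 3] -/
theorem finrank_hom_image_mirabolic_eq (hv₀ : v₀ ≠ 0) (hw₀ : w₀ ≠ 0)
    (hP₁ : ∀ A : GL n F, A ∈ P₁ ↔ (A : Matrix n n F) *ᵥ v₀ = v₀)
    (hP₂ : ∀ A : GL n F, A ∈ P₂ ↔ w₀ ᵥ* (A : Matrix n n F) = w₀)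
    (hN₁ : End.of N₁ = ∑ h : P₁, ρ h) (hN₂ : End.of N₂ = ∑ h : P₂, ρ h) (B : AbelianVariety K) :
    Module.finrank ℤ (image N₁ ⟶ B) = Module.finrank ℤ (image N₂ ⟶ B) :=
  finrank_hom_image_eq_of_gassmann ρ P₁ P₂
    (card_isConj_eq_of_card_conj_mem_eq P₁ P₂ (card_conj_mem_mirabolic_eq P₁ P₂ hv₀ hw₀ hP₁ hP₂)) hN₁ hN₂ B

variable [PerfectField K]

/-- **The mirabolic Gassmann pair gives isogenous `B`'s** (perfect field): **`B_{P₁} ∼ B_{P₂}`** for every abelian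
variety with a `GLₙ(𝔽_q)`-action, `P₁` the stabiliser of a non-zero vector, `P₂` of a non-zero covector — the isogeny
relation of the Brauer relation `P₁ − P₂` ("For every Brauer relation … there is an isogeny"); for `n ≥ 3` the two
subgroups are not conjugate (`MirabolicGassmann.mirabolic_not_conjugate`).
[cite: Prasad2017, Introduction] [cite: PrasadRajan2003, Cor. 4] [cite: KaniRosen1989, Thm. 3] [cite: DokchitserEtAl2022, §1.3 Thm. 1.3] -/
theorem isIsogenous_mirabolic (hv₀ : v₀ ≠ 0) (hw₀ : w₀ ≠ 0)
    (hP₁ : ∀ A : GL n F, A ∈ P₁ ↔ (A : Matrix n n F) *ᵥ v₀ = v₀)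
    (hP₂ : ∀ A : GL n F, A ∈ P₂ ↔ w₀ ᵥ* (A : Matrix n n F) = w₀)
    (hN₁ : End.of N₁ = ∑ h : P₁, ρ h) (hN₂ : End.of N₂ = ∑ h : P₂, ρ h) : IsIsogenous (image N₁) (image N₂) :=
  isIsogenous_of_card_conj_mem_eq ρ P₁ P₂ (card_conj_mem_mirabolic_eq P₁ P₂ hv₀ hw₀ hP₁ hP₂) hN₁ hN₂

/-- **Dimensions: `dim B_{P₁} = dim B_{P₂}`** (perfect field; for Jacobians `g(C̃/P₁) = g(C̃/P₂)`).
[cite: Prasad2017, Introduction] [cite: PrasadRajan2003, Cor. 4] -/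
theorem dim_mirabolic_eq (hv₀ : v₀ ≠ 0) (hw₀ : w₀ ≠ 0)
    (hP₁ : ∀ A : GL n F, A ∈ P₁ ↔ (A : Matrix n n F) *ᵥ v₀ = v₀)
    (hP₂ : ∀ A : GL n F, A ∈ P₂ ↔ w₀ ᵥ* (A : Matrix n n F) = w₀)
    (hN₁ : End.of N₁ = ∑ h : P₁, ρ h) (hN₂ : End.of N₂ = ∑ h : P₂, ρ h) : (image N₁).dim = (image N₂).dim :=
  (isIsogenous_mirabolic ρ P₁ P₂ hv₀ hw₀ hP₁ hP₂ hN₁ hN₂).dim_eq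

end MirabolicGassmannAV

end AbelianVariety

end Literature.AlgebraicGeometry.Motives
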